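import Literature.AlgebraicGeometry.Resolution.ProperModelsPatchingOfResolution
import Literature.AlgebraicGeometry.Resolution.ZariskiPatchingProperModels
import HarnessLib

/-!
# Resolution in characteristic `p` ⟺ two-model patching ∧ existence of regular models

Topic: `Literature/AlgebraicGeometry/Resolution`. Companion to `ProperModelsPatchingOfResolution.lean`
(`ProperModel.resolutionInChar_iff_twoModelPatching_and_relLU`: `Res_p ⟺ TwoModelPatching_p ∧ LUrel_p`).
Here the local-uniformization conjunct is replaced by the weakest GLOBAL statement, Zariski's 1944
"existence of a nonsingular model" (Piltant 2013, Thm. 2.4: a projective model `X'` with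
`Reg_P(X') = X'`): `ProperModel.RegModel p` — every function field over a field of
characteristic `p` having a proper model has a REGULAR proper model (a statement, OPEN in
dimension `≥ 4`; nobody may assert it). PROVED here (cdisprove gen 5 on crux
stmt-ResolutionOfSingularities-0642, (N10) of `Cruxes/PatchingRel/Disproof.lean`):

* `ProperModel.hasResolution_of_twoModelPatching_of_regModel` — two-model patching reduces the
  resolution of EVERY proper model to the existence of ONE regular model (patch `M` with the
  regular model `U`; the patch `N` is regular, being `RegLe` over `U`, and `N → M` is a
  resolution, `ProperModel.Hom.hasResolution`);
* `ProperModel.regModel_of_resolutionInChar` — the converse bookkeeping;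
* `ProperModel.resolutionInChar_of_twoModelPatching_of_regModel` — hence `ResolutionInChar p`
  from `TwoModelPatching p ∧ RegModel p`, WITHOUT local uniformization (integral projective
  varieties are proper models of their function fields, `ProjModel.ofChart`; general case by
  `ResolutionOverUpToDim.of_projective`);
* `ProperModel.resolutionInChar_iff_twoModelPatching_and_regModel` — the equivalence. So in the
  implication "LU ⇒ resolution" (crux `PatchingRel`), once two-model patching is available, local
  uniformization serves only to manufacture one regular proper model per function field
  (Zariski's resolving-system argument, `hasResolution_of_properPatching_of_relLU`).

## References

* O. Zariski, Ann. of Math. 45 (1944), Fundamental Theorem p. 539 (via Piltant).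
* O. Piltant, *An axiomatic version of Zariski's patching theorem*, RACSAM 107 (2013), Thm. 2.4,
  Prop. 5.1, Cor. 5.7. [Piltant2013]
-/

noncomputable section

open CategoryTheory AlgebraicGeometry

namespace Literature.AlgebraicGeometry.Resolution

universe u

namespace ProperModel

/-- **Existence of regular models in characteristic `p`** (Zariski's 1944 formulation of
resolution, "existence of a nonsingular projective model of `K`"; Piltant 2013, Thm. 2.4,
conclusion `Reg_P(X') = X'`, for proper models): every `K/k` essentially of finite type over a
field of characteristic `p` which has a proper model has a REGULAR proper model. Implied by
`ResolutionInChar p` (`regModel_of_resolutionInChar`); OPEN in transcendence degree `≥ 4` — a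
statement, not a fact: users take `(h : RegModel p)`, nobody may assert it.
[cite: Piltant2013, Thm. 2.4 (conclusion shape, proper models); open in trdeg ≥ 4, p. 2] -/
def RegModel (p : ℕ) : Prop :=
  ∀ (k : Type u) [Field k] [CharP k p] (K : Type u) [Field K] [Algebra k K]
    [Algebra.EssFiniteType k K], Nonempty (ProperModel k K) →
      ∃ N : ProperModel k K, Scheme.IsRegular N.X

/-- **Two-model patching reduces resolution of ALL proper models to the existence of ONE regular
model**: `TwoModelPatching p → RegModel p → ∀ M, HasResolution M.X` (patch `M` with the regular
model; the patch is regular because it is `RegLe` over a regular model). [cite: Piltant2013, Prop. 5.1 (use)] -/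
theorem hasResolution_of_twoModelPatching_of_regModel {p : ℕ} (hT : TwoModelPatching.{u} p)
    (hR : RegModel.{u} p) {k : Type u} [Field k] [CharP k p] {K : Type u} [Field K] [Algebra k K]
    [Algebra.EssFiniteType k K] (M : ProperModel k K) : Scheme.HasResolution M.X := by
  obtain ⟨U, hU⟩ := hR k K ⟨M⟩
  obtain ⟨N, φ₁, φ₂, -, h₂⟩ := hT k K M U
  have hN : Scheme.IsRegular N.X := fun n => h₂ n (hU _)
  exact φ₁.hasResolution hN

/-- `ResolutionInChar p ⇒ RegModel p` (resolve any proper model). [folklore] -/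
theorem regModel_of_resolutionInChar {p : ℕ} (h : ResolutionInChar.{u} p) : RegModel.{u} p := by
  intro k _ _ K _ _ _ hM
  obtain ⟨M⟩ := hM
  obtain ⟨N, -, hN⟩ := exists_hom_isRegular_of_hasResolution M
    (h k M.X M.π inferInstance inferInstance inferInstance inferInstance)
  exact ⟨N, hN⟩

/-- **Resolution of an integral projective variety from two-model patching and ONE regular model
of its function field** (no local uniformization): the variety is a proper model of its function
field (`ProjModel.ofChart`), patched with the regular model. [folklore] -/
theorem hasResolution_of_twoModelPatching_of_regModel_projective {p : ℕ} {k : Type u} [Field k]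
    [CharP k p] (hT : TwoModelPatching.{u} p) (hR : RegModel.{u} p)
    {n : ℕ} (X : Scheme.{u}) [IsIntegral X]
    (ι : X ⟶ (Motives.projectiveSpace n k).left) [IsClosedImmersion ι] :
    Scheme.HasResolution X := by
  classical
  haveI : IsProper (Motives.projectiveSpace n k).hom := Motives.isProper_projectiveSpace n k
  let πX : X ⟶ Spec (.of k) := ι ≫ (Motives.projectiveSpace n k).hom
  have hproj : Motives.IsProjectiveOver (Over.mk πX) := ⟨n, Over.homMk ι rfl, ‹_›⟩
  haveI : LocallyOfFiniteType πX := inferInstance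
  obtain ⟨_, ⟨U', hU', rfl⟩, hηU, -⟩ := X.isBasis_affineOpens.exists_subset_of_mem_open
    (Set.mem_univ (genericPoint X)) isOpen_univ
  let U : X.Opens := U'
  have hU : IsAffineOpen U := hU'
  haveI : IsAffine U := hU
  haveI : Nonempty U := ⟨⟨_, hηU⟩⟩
  let A : Type u := Γ(U, ⊤)
  let g : (U : Scheme.{u}) ⟶ Spec (.of k) := U.ι ≫ πX
  let ψ : k →+* A := g.appTop.hom.comp (Scheme.ΓSpecIso (.of k)).inv.hom
  have hψ : ψ.FiniteType := by
    have h1 : g.appTop.hom.FiniteType :=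
      (HasRingHomProperty.iff_of_isAffine (P := @LocallyOfFiniteType)).mp inferInstance
    exact h1.comp (RingHom.FiniteType.of_surjective _
      (Scheme.ΓSpecIso (.of k)).symm.commRingCatIsoToRingEquiv.surjective)
  letI : Algebra k A := ψ.toAlgebra
  haveI hft : Algebra.FiniteType k A := hψ
  let K : Type u := FractionRing A
  let j : Spec (.of A) ⟶ X := U.toScheme.isoSpec.inv ≫ U.ι
  have hj : j ≫ πX = Spec.map (CommRingCat.ofHom (algebraMap k A)) := by
    change (U.toScheme.isoSpec.inv ≫ U.ι) ≫ πX = Spec.map (CommRingCat.ofHom ψ)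
    rw [Category.assoc, isoSpec_inv_comp]
    rfl
  let M₀ : ProjModel k K := ProjModel.ofChart (K := K) X πX hproj A j hj
  haveI : Algebra.EssFiniteType k K := inferInstance
  exact hasResolution_of_twoModelPatching_of_regModel hT hR M₀.toProperModel

/-- **Resolution in characteristic `p` from two-model patching and the existence of regular
models** (no local uniformization hypothesis): reduction to the integral projective case by
`ResolutionOverUpToDim.of_projective`. [folklore] -/
theorem resolutionInChar_of_twoModelPatching_of_regModel {p : ℕ} (hT : TwoModelPatching.{u} p)
    (hR : RegModel.{u} p) : ResolutionInChar.{u} p := by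
  intro k _ _ X f hs hl hq hr
  haveI : QuasiCompact f := hq
  haveI : LocallyOfFiniteType f := hl
  haveI : CompactSpace X := QuasiCompact.compactSpace_of_compactSpace f
  obtain ⟨d, hd⟩ := exists_topologicalKrullDim_le_of_locallyOfFiniteType f
  refine (ResolutionOverUpToDim.of_projective (k := k) (d := d) fun m Y ι hι hY _ => ?_)
    X f hs hl hq hr hd
  haveI := hι
  haveI := hY
  exact hasResolution_of_twoModelPatching_of_regModel_projective hT hR Y ι

/-- **`ResolutionInChar p ⟺ TwoModelPatching p ∧ RegModel p`**: under two-model patching,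
resolution of singularities in characteristic `p` is EQUIVALENT to Zariski's "every function
field has a nonsingular proper model" — so in the crux `PatchingRel` (`LUrel_p → Res_p`, whose
open core is `TwoModelPatching`, `resolutionInChar_iff_twoModelPatching_and_relLU`) local
uniformization is needed only to manufacture ONE regular model per function field
(Zariski 1944 / Piltant 2013, Thm. 2.4). [folklore] -/
theorem resolutionInChar_iff_twoModelPatching_and_regModel (p : ℕ) :
    ResolutionInChar.{u} p ↔ TwoModelPatching.{u} p ∧ RegModel.{u} p :=
  ⟨fun h => ⟨twoModelPatching_of_resolutionInChar h, regModel_of_resolutionInChar h⟩,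
    fun h => resolutionInChar_of_twoModelPatching_of_regModel h.1 h.2⟩

end ProperModel

end Literature.AlgebraicGeometry.Resolution

end
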